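import Summits.ResolutionOfSingularities.ResolutionOfSingularities.Theorems.CouplingCutKernels
import HarnessLib

/-!
# RiderCutClasses — decomp-res node «RiderCut» (lens-4 g19; critic row 123: landing order 17:52:13Z)
refining the MaxContactCut aside 32260 (host of the lens-4 column).  Tree file 1/3 of the node.

Content VERBATIM from the decomp-res lens-4 g19 delta `HOME/decomp-res-lens-4/g19/parts/g19-new.lean` (sha256 8a1606b4756fe017;
= §32–§37 of `HOME/decomp-res-lens-4/g19/RiderCut.lean` @4ef41708, whose §1–§31 are g18 CouplingCut
@5bf7b2ca l.244–2968 VERBATIM and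
ALREADY in the tree as `Theorems/HugValuationCut*`, `MarkingBudget*`, `WeightDescent*`, `FactorContact*`,
`CouplingCut*` and their
`MaxContactCut<Node>` wiring files).  HOME = run/shared/lean/pub/decomp-res.  Critic order 2026-08-30T17:52:13Z.

Route-independent, OUTSIDE the Theses cone (importable by the route file for asides): §32 the RIDER AXIS —
`RiderMult`, `HugMult`,
the typed `RiderCensus` (structure) and its consequences (`RiderCensus.riderLaw`, `exists_commensurable_companion`,
`five_mul_pow_le`,
all PROVED from the census datum); §33 the cells of the GROUND-FIELD CUT of the g18 located residual (perfect / imperfect `k`,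
EXACT `incommensurableWildDrifting_iff_perfect_imperfect`, vacuous below weight 5); §34 the rider port `RiderPort`
(COSTUME, counted 0);
the all-weights classes `NoIncommensurableWildDriftingImperfectTowers` (THE LOCATED RESIDUAL of g19, weights ≥ 5 only:
`…_iff_five_le`) / `NoIncommensurableWildDriftingPerfectTowers` (decided half); §37 the RECURRENCE axis on the
residual, port-free:
`Free…`/`RecurrentIncommensurableWildDriftingImperfectTowersTerminate`, EXACT `…_iff_free_recurrent`, the free
part from the tree piece
`EventuallyFreeTowersTerminate` (31258 at weight `n`), `NoRecurrentIncommensurableWildDriftingImperfectTowers`.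
Kernels: `RiderCutKernels`; BY-NAME wiring to 30253 / 32260 / 31258: `MaxContactCutRiderCut`.

[WRITER NOTE (decomp-res writer g6): the whole lens-4 chain lives in ONE namespace `…Theorems.HugValuationCut` (the tree's g14
namespace) so that the lens's `HugChain.`/`HugShadow.`/`MarkedShadow.` dot-notation extends the landed structures
verbatim; the lens's
`noTower_iff_perfect_and_imperfect` is the tree's `ContactShadowKernels.noTower_iff_columns`; `set_option` lines
dropped; cone-free
(no `Theses` import) so the route file can import it for asides; the BY-NAME wiring to the MaxContactCut items is in the
`MaxContactCut<Node>` companion files.]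
(Sources: CossartJannsenSaito2020 Key Thm. 6.40, Cor. 6.37, Lem. 6.35/6.36; BierstoneGrigorievMilmanWlodarczyk2011
§3; CossartPiltant2019 (rider census, imperfect ground fields); Abhyankar1956; Cutkosky2009 §2.1; Giraud1975;
BierstoneMilman1997; Wlodarczyk2005; Kollar2007 §3.)
-/

noncomputable section

open CategoryTheory AlgebraicGeometry IsLocalRing
open Literature.AlgebraicGeometry.Resolution
open Summit.ResolutionOfSingularities.ResolutionOfSingularities.Theorems
open WeakOrderReduction ForcedTowerClasses DivergentTowerClasses MonomialTowerClasses
open HugDimensionClasses HugDimensionKernels SurfaceShadowClasses SurfaceShadowKernels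
open ContactShadowClasses (NoTowerImperfect)
open ContactShadowKernels (noTowerImperfect_of_noTower noTowerImperfect_mono noTower_iff_columns)
open NearPointCut (SingularClass singularSurface_iff_noTower)
open AbsoluteContactClasses (IsAbsContactAt)

namespace Summit.ResolutionOfSingularities.ResolutionOfSingularities.Theorems.HugValuationCut

variable {K : Type} [Field K]

/-! ## §32 (g19 · NEW) THE RIDER AXIS — riders, hugged multiplicities, and the typed RIDER CENSUS (the datum of the
extremal argument; its kernel is PORT-FREE ARITHMETIC: the MINIMAL hugged multiplicity of the tower is a prime power
`p^e` dividing BOTH factor orders of every impure principal shadow) -/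

/-- **RIDER of multiplicity `m`**: a hypersurface germ `V(r) ∋ pt j` born at some stage `j` (an ideal sheaf `H` with
PRINCIPAL stalk `(r)` at `pt j`) that is EQUIMULTIPLE ALONG THE WHOLE LATER TOWER — every iterated strict transform has
order exactly `m` at the marked point, `ord_{pt (j+i)} r̃_i = m` for all `i` (it «rides» the tower; a rider of
multiplicity `≥ 1` passes through every later point).  Port-level examples ((R1) of the module docstring): the hugged
hypersurface of a principal shadow from its stable stage (`m = ν`); an element of order `n − ν` of the cofactor `J_j` at
a stable stage (`m = n − ν`, by the product law (D3)); and — THE ENGINE — every DIFFERENTIAL DESCENDANT `D r̃_j`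
(`D ∈ Diff^{≤ i}`, `ord D r̃_j = m − i`) of a rider, by Giraud's shift law (tree
`IsBlowup.exists_isDiffOpLE_stalk_shift`,
any characteristic) and the non-increase of multiplicity under strict transform. -/
def RiderMult (T : ForcedTower) (m : ℕ) : Prop :=
  ∃ (j : ℕ) (H : (T.St j).IdealSheafData), (stalkIdeal H (T.pt j)).IsPrincipal ∧
    ∀ i : ℕ, idealOrder (strictIter T j H i) (T.pt (j + i)) = m

/-- **HUGGED MULTIPLICITY `m`**: some PRINCIPAL hug shadow of the tower (a hugged integral hypersurface germ with its
dictionary, §2 — born at ANY stage) has stable top order `m`. -/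
def HugMult (T : ForcedTower) (m : ℕ) : Prop :=
  ∃ S : HugShadow T, S.Principal ∧ ∃ j : ℕ, S.StableFrom j m

/-- a hugged multiplicity is positive (port-free: `HugShadow.one_le_topOrder`). [folklore] -/
theorem one_le_of_hugMult {T : ForcedTower} {m : ℕ} (h : HugMult T m) : 1 ≤ m := by
  obtain ⟨S, -, j, hs⟩ := h
  have h1 : (1 : ℕ∞) ≤ S.topOrder j := S.one_le_topOrder j
  rw [hs j le_rfl] at h1
  exact_mod_cast h1

/-- **THE RIDER CENSUS of the shadow `S` at weight `n` in characteristic `p`** — the typed DATUM of the extremal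
(minimal-hugged-multiplicity) argument, delivered by the COSTUME port `RiderPort` (§34); every field is a LAW with a
complete paper proof ((R0)–(R4) of the module docstring; FOUR laws — (R0) is derived, `RiderCensus.two_le`):
* `rider_of_hug` (R1a): a principal hug shadow of stable order `m` is, from its stable stage, a rider of multiplicity `m`;
* `rider_tail` (R1b): at a stable stage of `S` (value `ν`; in-locus principal: `I_j = g_j · J_j`, `ord J_j = n − ν` for
  ever, (D3)) an element of `J_j` of order `n − ν` is a rider of multiplicity `n − ν`;
* `hug_of_rider` (R2): a rider of multiplicity `m ≥ 1` has an irreducible component hugged for ever, of stable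
  multiplicity `m′` with `2 ≤ m′ ≤ m` (König over the finite factor forests + persistence; the bound `2 ≤
m′` is (R0): a
  hugged germ of stable multiplicity `1` is a REGULAR surface germ hugged for ever — dictionary clause `HugShadow.regular` —
  excluded in the singular class; (R0) for ALL hugged multiplicities is then the PROVED `RiderCensus.two_le`);
* `descent` (R3): THE HASSE–LUCAS DESCENT LAW over a PERFECT ground field — a rider `r` of multiplicity `m ≥ 1` has a
  monomial `X^{e₀} Y^{e₁} Z^{e₂}` (`e₀ + e₁ + e₂ = m`) in its initial form at its birth point, and for
every nonzero exponent
  `eᵢ` whose exact prime-power part `q = p^{v_p(eᵢ)}` is `< m`, the Hasse derivative `D = ∂^{(e − q·𝟙ᵢ)}` of order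
  `m − q` has `ord D r = q` (Lucas: `binom(eᵢ, q) ≢ 0 mod p`), and `D r` is a RIDER OF MULTIPLICITY `q` (engine (R1c)). -/
structure RiderCensus (p n : ℕ) {T : ForcedTower} (S : HugShadow T) : Prop where
  /-- (R1a) hugged germs ride -/
  rider_of_hug : ∀ m : ℕ, HugMult T m → RiderMult T m
  /-- (R1b) the cofactor supplies a rider of the complementary multiplicity -/
  rider_tail : ∀ j ν : ℕ, S.StableFrom j ν → RiderMult T (n - ν)
  /-- (R2) a rider has a hugged component -/
  hug_of_rider : ∀ m : ℕ, RiderMult T m → 1 ≤ m → ∃ m' : ℕ, 2 ≤ m' ∧ m' ≤ m ∧ HugMult T m'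
  /-- (R3) the Hasse–Lucas descent law (perfect ground field) -/
  descent : ∀ m : ℕ, RiderMult T m → 1 ≤ m → ∃ e : Fin 3 → ℕ, Finset.univ.sum e = m ∧
    ∀ i : Fin 3, e i ≠ 0 → p ^ padicValNat p (e i) < m → RiderMult T (p ^ padicValNat p (e i))

namespace RiderCensus

variable {p n : ℕ} {T : ForcedTower} {S : HugShadow T}

/-- a rider multiplicity `m ≥ 1` is at least every lower bound of the hugged multiplicities (through its hugged
component). [folklore] -/
theorem le_of_rider (h : RiderCensus p n S) {ε m : ℕ} (hεmin : ∀ m', HugMult T m' → ε ≤ m') (hm : RiderMult T m)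
    (h1 : 1 ≤ m) : ε ≤ m := by
  obtain ⟨m', -, hm'le, hm'hug⟩ := h.hug_of_rider m hm h1
  exact (hεmin m' hm'hug).trans hm'le

/-- **(R0) from (R1a) + (R2), port-free**: every hugged multiplicity is `≥ 2` — the hugged germ rides (R1a), and a rider of
multiplicity `m ≥ 1` (`one_le_of_hugMult`) has a hugged component of multiplicity in `[2, m]` (R2). [folklore] -/
theorem two_le (h : RiderCensus p n S) (m : ℕ) (hm : HugMult T m) : 2 ≤ m := by
  obtain ⟨m', h2, hle, -⟩ := h.hug_of_rider m (h.rider_of_hug m hm) (one_le_of_hugMult hm)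
  omega

/-- **KERNEL (PORT-FREE ARITHMETIC) — THE MINIMAL HUGGED MULTIPLICITY IS A PRIME POWER.**  If `ε` is a hugged
multiplicity below every hugged multiplicity, then `ε = p^e` with `e ≥ 1`: a monomial of the initial form of the minimal
germ has a nonzero exponent `eᵢ ≤ ε`; were its prime-power part `q = p^{v_p(eᵢ)}` below `ε`, the descendant rider of
multiplicity `q` would have a hugged component of multiplicity `≤ q < ε`; so `ε ≤ q ≤ eᵢ ≤ ε`. [folklore] -/
theorem minimal_eq_prime_pow (h : RiderCensus p n S) (hp : p.Prime) {ε : ℕ} (hε : HugMult T ε)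
    (hεmin : ∀ m', HugMult T m' → ε ≤ m') : ∃ e : ℕ, 1 ≤ e ∧ ε = p ^ e := by
  have hε2 : 2 ≤ ε := h.two_le ε hε
  obtain ⟨f, hsum, hdesc⟩ := h.descent ε (h.rider_of_hug ε hε) (by omega)
  obtain ⟨i, hi⟩ : ∃ i, f i ≠ 0 := by
    by_contra hall
    have hall' : ∀ i, f i = 0 := fun i => by_contra fun hi => hall ⟨i, hi⟩
    have : Finset.univ.sum f = 0 := Finset.sum_eq_zero fun i _ => hall' i
    omega
  have hfi_le : f i ≤ ε := hsum ▸ Finset.single_le_sum (f := f) (fun _ _ => Nat.zero_le _) (Finset.mem_univ i)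
  have hq_dvd : p ^ padicValNat p (f i) ∣ f i := pow_padicValNat_dvd
  have hq_le : p ^ padicValNat p (f i) ≤ f i := Nat.le_of_dvd (Nat.pos_of_ne_zero hi) hq_dvd
  have hq1 : 1 ≤ p ^ padicValNat p (f i) := Nat.one_le_pow _ _ hp.pos
  have hnot : ¬ p ^ padicValNat p (f i) < ε := fun hlt => by
    have := h.le_of_rider hεmin (hdesc i hi hlt) hq1
    omega
  have hεeq : ε = p ^ padicValNat p (f i) := by omega
  refine ⟨padicValNat p (f i), ?_, hεeq⟩
  by_contra h0
  have h0' : padicValNat p (f i) = 0 := by omega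
  rw [h0', pow_zero] at hεeq
  omega

/-- **KERNEL (PORT-FREE ARITHMETIC) — THE MINIMAL HUGGED MULTIPLICITY DIVIDES EVERY RIDER MULTIPLICITY.**  With
`ε = p^e` minimal among hugged multiplicities, every rider multiplicity `m ≥ 1` is divisible by `p^e`: each nonzero
exponent `eᵢ` of the recorded monomial has `v_p(eᵢ) ≥ e` (else the descendant of multiplicity `p^{v_p(eᵢ)} <
p^e` — or,
when `p^{v_p(eᵢ)} = m`, the rider itself — has a hugged component below `ε`). [folklore] -/
theorem pow_dvd_of_rider (h : RiderCensus p n S) (hp : p.Prime) {ε e : ℕ} (hεmin : ∀ m', HugMult T m' → ε ≤ m')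
    (hεe : ε = p ^ e) {m : ℕ} (hm : RiderMult T m) (h1 : 1 ≤ m) : p ^ e ∣ m := by
  obtain ⟨f, hsum, hdesc⟩ := h.descent m hm h1
  have hεm : ε ≤ m := h.le_of_rider hεmin hm h1
  rw [← hsum]
  refine Finset.dvd_sum fun i _ => ?_
  by_cases hi : f i = 0
  · rw [hi]; exact dvd_zero _
  · have hfi_le : f i ≤ m := hsum ▸ Finset.single_le_sum (f := f) (fun _ _ => Nat.zero_le _) (Finset.mem_univ i)
    have hq_dvd : p ^ padicValNat p (f i) ∣ f i := pow_padicValNat_dvd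
    have hq_le : p ^ padicValNat p (f i) ≤ f i := Nat.le_of_dvd (Nat.pos_of_ne_zero hi) hq_dvd
    have hq1 : 1 ≤ p ^ padicValNat p (f i) := Nat.one_le_pow _ _ hp.pos
    suffices hle : e ≤ padicValNat p (f i) from (pow_dvd_pow p hle).trans hq_dvd
    by_contra hlt
    have hpow : p ^ padicValNat p (f i) < p ^ e := Nat.pow_lt_pow_right hp.one_lt (Nat.lt_of_not_le hlt)
    by_cases hqm : p ^ padicValNat p (f i) < m
    · have := h.le_of_rider hεmin (hdesc i hi hqm) hq1
      omega
    · omega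

/-- **KERNEL — THE RIDER LAW (PORT-FREE from the census)**: on a principal shadow with a stable value `ν < n` the MINIMAL
hugged multiplicity of the tower is a prime power `p^e ≥ 2` (`e ≥ 1`) with `p^e ≤ ν`, `p^e ∣ ν`, `p^e ∣
n − ν`, `p^e ∣ n` —
THE NORMAL FORM OF THE WHOLE IMPURE PRINCIPAL COLUMN OVER PERFECT FIELDS (in particular `p ∣ ν` and `p ∣ n − ν`: every
impure principal tower of the singular class over a perfect field is BI-WILD IN THE ARITHMETIC SENSE, and `2p ≤
n`). [folklore] -/
theorem riderLaw (h : RiderCensus p n S) (hp : p.Prime) (hP : S.Principal) {j ν : ℕ} (hs : S.StableFrom j ν)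
    (hνn : ν < n) :
    ∃ e : ℕ, 1 ≤ e ∧ HugMult T (p ^ e) ∧ (∀ m', HugMult T m' → p ^ e ≤ m') ∧
      p ^ e ≤ ν ∧ p ^ e ∣ ν ∧ p ^ e ∣ (n - ν) ∧ p ^ e ∣ n := by
  classical
  have hν : HugMult T ν := ⟨S, hP, j, hs⟩
  have hex : ∃ m, HugMult T m := ⟨ν, hν⟩
  have hεhug : HugMult T (Nat.find hex) := Nat.find_spec hex
  have hεmin : ∀ m', HugMult T m' → Nat.find hex ≤ m' := fun m' hm' => Nat.find_min' hex hm'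
  obtain ⟨e, he1, hεe⟩ := h.minimal_eq_prime_pow hp hεhug hεmin
  have hν1 : 1 ≤ ν := le_trans (by norm_num) (h.two_le ν hν)
  have hdν : p ^ e ∣ ν := h.pow_dvd_of_rider hp hεmin hεe (h.rider_of_hug ν hν) hν1
  have hdμ : p ^ e ∣ (n - ν) := h.pow_dvd_of_rider hp hεmin hεe (h.rider_tail j ν hs) (by omega)
  have hdn : p ^ e ∣ n := by
    have : n = ν + (n - ν) := by omega
    rw [this]; exact dvd_add hdν hdμ
  exact ⟨e, he1, hεe ▸ hεhug, fun m' hm' => hεe ▸ hεmin m' hm', hεe ▸ hεmin ν hν, hdν, hdμ, hdn⟩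

/-- **KERNEL — THE COMMENSURABLE COMPANION (PORT-FREE from the census)**: an INCOMMENSURABLE principal shadow forces a
SECOND principal hug shadow of the same tower which is IMPURE and COMMENSURABLE — the minimal hugged germ, of stable
multiplicity `p^e` with `p^e ∣ n − p^e` (case `p^e = ν` is excluded: it would give `ν ∣ n − ν`).  This is the whole
reduction of the incommensurable residual over perfect fields to g18's decided cell. [folklore] -/
theorem exists_commensurable_companion (h : RiderCensus p n S) (hp : p.Prime) (hP : S.Principal)
    (hi : S.Incommensurable n) :
    ∃ S' : HugShadow T, S'.Principal ∧ ¬ S'.Pure n ∧ S'.Commensurable n ∧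
      ∃ e j' : ℕ, 1 ≤ e ∧ S'.StableFrom j' (p ^ e) ∧ p ^ e ∣ n ∧
        ∀ j ν : ℕ, S.StableFrom j ν → p ^ e < ν ∧ p ^ e ∣ ν ∧ p ^ e ∣ (n - ν) := by
  have hi' := hi
  obtain ⟨j, ν, hs, hndvd, -⟩ := hi'
  obtain ⟨-, -, -, hνn, -⟩ := hi.numerics hs
  obtain ⟨e, he1, ⟨S', hP', j', hs'⟩, hmin, hle, hdν, hdμ, hdn⟩ := h.riderLaw hp hP hs hνn
  have hne : p ^ e ≠ ν := by
    rintro heq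
    rw [heq] at hdμ
    exact hndvd hdμ
  have hlt : p ^ e < ν := lt_of_le_of_ne hle hne
  refine ⟨S', hP', ?_, ?_, e, j', he1, hs', hdn, fun j₁ ν₁ hs₁ => ?_⟩
  · rintro ⟨j₀, hj₀⟩
    have := hs'.unique (show S'.StableFrom j₀ n from hj₀)
    omega
  · intro j₁ ν₁ hs₁
    obtain rfl : ν₁ = p ^ e := hs₁.unique hs'
    obtain ⟨c, hc⟩ := hdn
    exact Or.inl ⟨c - 1, by rw [hc, Nat.mul_sub_one]⟩
  · obtain rfl : ν₁ = ν := hs₁.unique hs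
    exact ⟨hlt, hdν, hdμ⟩

/-- numerics of the companion on the located residual: `p^e < ν`, `p^e ∣ ν`, `p^e ∣ n − ν`, hence `2·p^e ≤ ν` and
`n ≥ 5·p^e` (with g18's `five_mul_le_add_of_dvd_of_not_dvd`). [folklore] -/
theorem five_mul_pow_le (h : RiderCensus p n S) (hp : p.Prime) (hP : S.Principal) (hi : S.Incommensurable n) :
    ∃ e : ℕ, 1 ≤ e ∧ HugMult T (p ^ e) ∧ 5 * p ^ e ≤ n := by
  have hi' := hi
  obtain ⟨j, ν, hs, h1, h2⟩ := hi'
  obtain ⟨S', hP', -, -, e, j', he1, hs', -, hlaw⟩ := h.exists_commensurable_companion hp hP hi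
  obtain ⟨-, hdν, hdμ⟩ := hlaw j ν hs
  exact ⟨e, he1, ⟨S', hP', j', hs'⟩, hi.five_mul_le hs hdν hdμ⟩

end RiderCensus

/-! ## §33 (g19 · NEW) The cells of the GROUND-FIELD CUT of g18's located residual (perfect / imperfect `k`; EXACT by
excluded middle, port-free) -/

/-- **CELL (L,P,drift,wild,incomm · PERFECT k) · DECIDED-MOD-PORT (`RiderPort` + g18's `CouplingPort`) + LOWER
WEIGHTS — EMPTY**
(`incommensurableWildDriftingPerfect_of_ports`): g18's located residual over PERFECT ground fields — this contains EVERY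
census bed (all run over `𝔽_p`), in particular the designed window `p = 2`, `n = 10`, `{ν, n − ν} = {4, 6}`. -/
def IncommensurableWildDriftingPerfectTowersTerminate (n : ℕ) : Prop :=
  NoTowerPerfect n fun T => SingularClass T ∧ InLocusShadow T ∧
    ∃ S : HugShadow T, S.Principal ∧ ¬ S.Pure n ∧ S.Drifting n ∧ S.BiWild n ∧ S.Incommensurable n

/-- **CELL (L,P,drift,wild,incomm · IMPERFECT k) = THE LOCATED RESIDUAL of this generation · UNDECIDED · IDEA-NEEDED**:
g18's residual over IMPERFECT ground fields (`¬ PerfectField k`): the Hasse–Lucas descent law (R3) needs `p`-bases /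
regular-versus-smooth care at residually inseparable points (Kawanoue 2007 §0.4.2) — no census footprint (every bed is
over a finite field).  Numerics PROVED (inherited): `2 ≤ ν`, `2 ≤ n − ν`, `ν ≠ n − ν`, `n ≥ 5`;
EMPTY at `n ≤ 4`. -/
def IncommensurableWildDriftingImperfectTowersTerminate (n : ℕ) : Prop :=
  NoTowerImperfect n fun T => SingularClass T ∧ InLocusShadow T ∧
    ∃ S : HugShadow T, S.Principal ∧ ¬ S.Pure n ∧ S.Drifting n ∧ S.BiWild n ∧ S.Incommensurable n

/-- the incommensurable slab of the impure principal column over perfect fields (display; EMPTY mod ports + lower weights). -/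
def IncommensurableImpurePerfectTowersTerminate (n : ℕ) : Prop :=
  NoTowerPerfect n fun T => SingularClass T ∧ InLocusShadow T ∧
    ∃ S : HugShadow T, S.Principal ∧ ¬ S.Pure n ∧ S.Incommensurable n

/-- THE WHOLE IMPURE PRINCIPAL COLUMN OVER PERFECT FIELDS (display; EMPTY mod ports + lower weights:
`impurePrincipalPerfect_of_ports`). -/
def ImpurePrincipalPerfectTowersTerminate (n : ℕ) : Prop :=
  NoTowerPerfect n fun T => SingularClass T ∧ InLocusShadow T ∧ ∃ S : HugShadow T, S.Principal ∧ ¬ S.Pure n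

/-- **KERNEL — THE EXACT GROUND-FIELD CUT of g18's located residual, PORT-FREE (excluded middle on `PerfectField k`)**:
`(L,P,drift,wild,incomm) ⟺ (… · perfect) ∧ (… · imperfect)`. [folklore] -/
theorem incommensurableWildDrifting_iff_perfect_imperfect {n : ℕ} :
    IncommensurableWildDriftingTowersTerminate n ↔
      IncommensurableWildDriftingPerfectTowersTerminate n ∧ IncommensurableWildDriftingImperfectTowersTerminate n :=
  noTower_iff_columns _

/-- the imperfect residual is EMPTY at every weight `n ≤ 4` (PROVED, port-free). [folklore] -/
theorem incommensurableWildDriftingImperfect_of_le_four {n : ℕ} (hn : n ≤ 4) :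
    IncommensurableWildDriftingImperfectTowersTerminate n :=
  (incommensurableWildDrifting_iff_perfect_imperfect.mp (incommensurableWildDrifting_of_le_four hn)).2

/-- Necessity, port-free: g18's residual implies the g19 residual. [folklore] -/
theorem incommensurableWildDriftingImperfect_of_g18 {n : ℕ} (h : IncommensurableWildDriftingTowersTerminate n) :
    IncommensurableWildDriftingImperfectTowersTerminate n :=
  (incommensurableWildDrifting_iff_perfect_imperfect.mp h).2

/-! ## §34 (g19 · NEW) The rider port (COSTUME: delivers the typed `RiderCensus` over PERFECT ground fields; complete
paper proof (R0)–(R4) in the module docstring — Giraud's shift law is the TREE theorem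
`IsBlowup.exists_isDiffOpLE_stalk_shift`, the Hasse basis and Lucas are Kawanoue 2007 Lemma 1.2.1.2 / Remark 1.2.1.3 (2)
after EGA IV 16.11.2) -/

/-- **PORT `RiderPort n` — THE RIDER CENSUS EXISTS over perfect ground fields**: for an infinite forced tower of the
singular class over a PERFECT field of characteristic `p`, in-locus, and an in-locus PRINCIPAL IMPURE shadow `S`, the four
laws (R1a) `rider_of_hug`, (R1b) `rider_tail`, (R2) `hug_of_rider` (carrying (R0) as its bound `2 ≤ m′`), (R3)
`descent` hold.  COSTUME = a typed
conjunction of classical facts with a re-walkable paper proof (module docstring (R0)–(R4)); its kernel consequences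
(`RiderCensus.riderLaw`, `RiderCensus.exists_commensurable_companion`) are PROVED port-free. -/
def RiderPort (n : ℕ) : Prop :=
  ∀ p : ℕ, p.Prime → ∀ (k : Type) [Field k] [CharP k p] [PerfectField k] (T : ForcedTower) (g : T.St 0 ⟶ Spec (.of k)),
    IsBase (T.St 0) g → IsDatum n (T.D 0) → (T.D 0).boundary = [] → SingularClass T →
      ∀ S : HugShadow T, S.InLocus → S.Principal → ¬ S.Pure n → RiderCensus p n S

/-- the port over all weights. -/
def RiderPortAll : Prop := ∀ n : ℕ, 1 ≤ n → RiderPort n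

/-! ## §36 (g19 · NEW) Up to the booked MaxContactCut items BY NAME — all weights -/

/-- The located residual (L,P,drift,wild,incomm · IMPERFECT k) over all weights (vacuous below `5`). -/
def NoIncommensurableWildDriftingImperfectTowers : Prop :=
  ∀ n : ℕ, 1 ≤ n → IncommensurableWildDriftingImperfectTowersTerminate n

/-- The decided half over all weights (a CONSEQUENCE of the ports through the induction). -/
def NoIncommensurableWildDriftingPerfectTowers : Prop :=
  ∀ n : ℕ, 1 ≤ n → IncommensurableWildDriftingPerfectTowersTerminate n

/-- **THE RESIDUAL LIVES AT WEIGHTS `≥ 5` ONLY (PROVED).** [folklore] -/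
theorem noIncommensurableWildDriftingImperfectTowers_iff_five_le :
    NoIncommensurableWildDriftingImperfectTowers ↔
      ∀ n : ℕ, 5 ≤ n → IncommensurableWildDriftingImperfectTowersTerminate n :=
  ⟨fun h n hn => h n (by omega), fun h n _ =>
    (Nat.lt_or_ge n 5).elim (fun _ => incommensurableWildDriftingImperfect_of_le_four (by omega)) (h n)⟩

/-! ## §37 (g19 · NEW, rider) The RECURRENCE axis on the new located residual: its eventually-free part is 31258
`MaxContactCut.NoEventuallyFreeTowers` BY NAME (port-free, as in §31) -/

/-- the eventually-free part of the g19 residual (a sub-case of the tree piece `EventuallyFreeTowersTerminate n`). -/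
def FreeIncommensurableWildDriftingImperfectTowersTerminate (n : ℕ) : Prop :=
  NoTowerImperfect n fun T => EventuallyFreeOwn T ∧ (SingularClass T ∧ InLocusShadow T ∧
    ∃ S : HugShadow T, S.Principal ∧ ¬ S.Pure n ∧ S.Drifting n ∧ S.BiWild n ∧ S.Incommensurable n)

/-- **CELL (L,P,drift,wild,incomm · IMPERFECT k · RECURRENT) = the located residual after the rider · UNDECIDED
· IDEA-NEEDED.** -/
def RecurrentIncommensurableWildDriftingImperfectTowersTerminate (n : ℕ) : Prop :=
  NoTowerImperfect n fun T => SatelliteRecurrent T ∧ (SingularClass T ∧ InLocusShadow T ∧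
    ∃ S : HugShadow T, S.Principal ∧ ¬ S.Pure n ∧ S.Drifting n ∧ S.BiWild n ∧ S.Incommensurable n)

/-- **EXACT RECURRENCE CUT of the g19 residual, PORT-FREE.** [folklore] -/
theorem incommensurableWildDriftingImperfect_iff_free_recurrent {n : ℕ} :
    IncommensurableWildDriftingImperfectTowersTerminate n ↔
      FreeIncommensurableWildDriftingImperfectTowersTerminate n ∧
        RecurrentIncommensurableWildDriftingImperfectTowersTerminate n := by
  refine ⟨fun h => ⟨noTowerImperfect_mono (fun _ h' => h'.2) h, noTowerImperfect_mono (fun _ h' => h'.2) h⟩, ?_⟩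
  rintro ⟨h₁, h₂⟩ p hp k _ _ hk T g hB hD hE hT
  by_cases hf : EventuallyFreeOwn T
  · exact h₁ p hp k hk T g hB hD hE ⟨hf, hT⟩
  · exact h₂ p hp k hk T g hB hD hE ⟨satelliteRecurrent_iff_not_eventuallyFree.mpr hf, hT⟩

/-- EDGE BY NAME into the tree piece `EventuallyFreeTowersTerminate n` (item 31258 at weight `n`). [folklore] -/
theorem freeIncommensurableWildDriftingImperfect_of_tree {n : ℕ} (h : EventuallyFreeTowersTerminate n) :
    FreeIncommensurableWildDriftingImperfectTowersTerminate n :=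
  fun p hp k _ _ _ T g hB hD hE hT => h p hp k T g hB hD hE hT.1

/-- the g19 residual from 31258 at weight `n` and its recurrent part. [folklore] -/
theorem incommensurableWildDriftingImperfect_of_recurrent {n : ℕ} (h : EventuallyFreeTowersTerminate n)
    (hRec : RecurrentIncommensurableWildDriftingImperfectTowersTerminate n) :
    IncommensurableWildDriftingImperfectTowersTerminate n :=
  incommensurableWildDriftingImperfect_iff_free_recurrent.mpr ⟨freeIncommensurableWildDriftingImperfect_of_tree h, hRec⟩

/-- the recurrent residual over all weights. -/
def NoRecurrentIncommensurableWildDriftingImperfectTowers : Prop :=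
  ∀ n : ℕ, 1 ≤ n → RecurrentIncommensurableWildDriftingImperfectTowersTerminate n

end Summit.ResolutionOfSingularities.ResolutionOfSingularities.Theorems.HugValuationCut
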